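import Summits.FinalStateConjecture.FinalStateConjecture.Theorems.SwallowTheDatumKerrShieldedSettlesStubExteriorTransport
import Summits.FinalStateConjecture.FinalStateConjecture.Theorems.SwallowTheDatumKerrShieldedSettlesStubKerrExteriorHelix
import HarnessLib

set_option linter.dupNamespace false

/-!
# Stub `stub_causalTransport` (T7) of line `swallow-transfer`, crux `EIHFluxBalance.ModulatedKerrHandoff` (stmt-FinalStateConjecture-10167)

Support file for crux `stmt-FinalStateConjecture-10167`
(`Summit.FinalStateConjecture.FinalStateConjecture.Theses.EIHFluxBalance.ModulatedKerrHandoff`), line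
`swallow-transfer`: the registered stub `stub_causalTransport` (statement VERBATIM from the registered skeleton), as a
one-line corollary of the transport theorem `causalTransport_of_chart` for an abstract lab chart `f` (registered
helper sub-goal of T7 on the same item).

**Transport of the causal clauses through the collar embedding.**  Let `χ : Kerr.region a r₁ → 𝓢` be smooth,
isometric and oriented on the tapered collar `W = {0 < x⁰ − T(r) + (r − r₁)/4}` (`T = bentHeight M a`) of the
sub-extremal ingoing Kerr–Schild chart (`|a| < M`, `r₋ < r₁ < r₊`), mapping the bent leaf `{x⁰ = T(r)}` into a set
`Σ` (for a Cauchy development: `Σ = ι(X)`, because `χ ∘ ψ = ι ∘ φ` on the leaf `ψ = graph T`), and satisfying the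
last-exit inclusion `J⁺(Σ) ∩ I⁻(χ(O_K)) ⊆ χ(O_K)`, `O_K = {r > r₊, x⁰ ≥ T(r)}`.  Let `f : E4 → E4` be a lab chart
above the leaf (`T(r x) < (f x)⁰` for `x⁰ > τ₀`), radius preserving, mapping the late sets `{x⁰ > t₁, r > r₊}` onto
the epigraphs `{y⁰ > t₁ + Θ(t₁, y), r > r₊}` and the slabs `{x⁰ = t₁, r > r₊}` onto the graphs
`{y⁰ = t₁ + Θ(t₁, y), r > r₊}` of a height `Θ(t₁, y)` depending on `y` only through `|y̲|`, and let `Φ = χ ∘ f` on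
the pinned domain `U = {x⁰ > τ₀, r > r₁}`.  Then (a) `Φ(late exterior) ⊆ χ(O_K)`; (b)
`χ(O_K) = J⁺(Σ) ∩ I⁻(Φ(late exterior))`; (c) for every `t₁ > τ₀`, `χ(O_K) ∖ Φ({x⁰ > t₁} ∩ ext) ⊆
J⁻(Φ({x⁰ = t₁} ∩ ext))`.  The connecting curves are the DRSR helices `s ↦ (x⁰ + s, R_{ωs} x̲)` of the
sub-extremal exterior (`stub_kerrExteriorHelix`, crux 10054: constant `r` and constant `|x̲|`, future timelike),
pushed through `χ` by the engines `ExteriorTransport.image_causalFuture_subset_of_le`,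
`mem_chronologicalPast_image_of_le`, `mem_causalPast_image_of_le` of crux 10054 (future causal chart curves from
`{x⁰ ≥ T(r)}` stay in `W`, where `χ` is isometric and oriented).

References: B. O'Neill, *Semi-Riemannian geometry* (1983), Ch. 14, pp. 402–403 (causality relations, time
duality); M. Dafermos, I. Rodnianski, Y. Shlapentokh-Rothman, arXiv:1402.7034, Lemma 4.7.1 (the timelike span
`∂_{t*} + ω(r) ∂_φ`); M. Dafermos, J. Luk, arXiv:1710.01722, Conjecture 1 (the exterior region `J⁺(ιX) ∩ I⁻`).
-/

noncomputable section

open Set Filter Function TopologicalSpace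
open scoped Manifold ContDiff Topology
open Literature.Geometry.Lorentzian
open Summit.FinalStateConjecture.FinalStateConjecture.Theorems.KerrShieldedDataExist.Negative
  (bentHeight graph psi_eq_graph mass_pos rMinus_nonneg)
open Summit.FinalStateConjecture.FinalStateConjecture.Theorems.SwallowTheDatum.KerrShieldedSettles
  (stub_kerrExteriorHelix)
open Summit.FinalStateConjecture.FinalStateConjecture.Theorems.SwallowTheDatum.KerrShieldedSettles.ExteriorTransport
  (image_causalFuture_subset_of_le mem_causalPast_image_of_le mem_chronologicalPast_image_of_le)
open Summit.FinalStateConjecture.FinalStateConjecture.Theorems.SwallowTheDatum.KerrShieldedSettles.CollarEmbedsMGHD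
  (exists_graph_eq_iff)

namespace Summit.FinalStateConjecture.FinalStateConjecture.Cruxes.ModulatedKerrHandoff.SwallowTransfer

/-- **The helix preserves the spatial radius.**  The point `(x⁰ + t, x₁ cos θ − x₂ sin θ, x₁ sin θ + x₂ cos θ, x₃)`
(a rotation of the `(x₁, x₂)`-plane followed by a `t*`-translation) has the spatial radius `|x̲|` of `x`
(`cos² + sin² = 1`). [folklore] -/
private theorem causalTransport_spatialNorm_helix (x : E4) (t θ : ℝ) :
    E4.spatialNorm (WithLp.toLp 2 ![x 0 + t, x 1 * Real.cos θ - x 2 * Real.sin θ,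
        x 1 * Real.sin θ + x 2 * Real.cos θ, x 3] : E4) = E4.spatialNorm x := by
  rw [← sq_eq_sq₀ (E4.spatialNorm_nonneg _) (E4.spatialNorm_nonneg _), E4.spatialNorm_sq,
    E4.spatialNorm_sq]
  simp
  linear_combination (x 1 ^ 2 + x 2 ^ 2) * Real.sin_sq_add_cos_sq θ

/-- **The causal transport, for an abstract lab chart `f`** (registered helper sub-goal of T7 on crux
stmt-FinalStateConjecture-10167, stated in `∀`-form).  For a chart map `χ` into a spacetime `𝓢`, smooth, isometric
and oriented on the collar `W` of the sub-extremal ingoing Kerr–Schild chart, mapping the bent leaf `{x⁰ = T(r)}` into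
`Σ` and with the last-exit inclusion `J⁺(Σ) ∩ I⁻(χ(O_K)) ⊆ χ(O_K)`; a lab chart `f` above the leaf, radius
preserving, whose images of the late sets / slabs over `{r > r₊}` are the epigraphs / graphs of `y ↦ t₁ + Θ(t₁, y)`
with `Θ(t₁, y)` a function of `|y̲|`; the pinned domain `U = {x⁰ > τ₀, r > r₁}` and `Φ = χ ∘ f` on `U`:
(a) `Φ(late exterior) ⊆ χ(O_K)` (`r(f x) = r x > r₊`, `(f x)⁰ > T(r x)`); (b) `χ(O_K) = J⁺(Σ) ∩ I⁻(Φ(late exterior))`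
(`⊆`: `x ∈ O_K` lies on the future helix segment from the leaf point `(T(r x), R_{−ωΔ} x̲)`, mapped into `Σ`, and
the helix point `(x⁰ + Δ, R_{ωΔ} x̲)`, `Δ` large, lies in the epigraph `f({x⁰ > τ₀, r > r₊})` since `|x̲|`, `r` are
constant along the helix; push through `χ`; `⊇`: last exit and `I⁻(Φ(late)) ⊆ I⁻(χ(O_K))` by (a)); (c) a point
`χ x`, `x ∈ O_K`, not in `Φ({x⁰ > t₁} ∩ ext)` has `x⁰ ≤ t₁ + Θ(t₁, x)` (epigraph identity), so the helix point with
`Δ = t₁ + Θ(t₁, x) − x⁰ ≥ 0` lies on the graph `f({x⁰ = t₁} ∩ ext)` and `x ∈ J⁻` of it; push through `χ`.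
O'Neill 1983, Ch. 14, pp. 402–403; DRSR arXiv:1402.7034, Lemma 4.7.1; Dafermos–Luk arXiv:1710.01722, Conjecture 1.
[folklore] -/
theorem causalTransport_of_chart :
    open Literature.Geometry.Lorentzian Summit.FinalStateConjecture.FinalStateConjecture.Theorems.KerrShieldedDataExist.Negative in
    ∀ [Kerr.Facts] {M a r₁ τ₀ : ℝ}, |a| < M → Kerr.rMinus M a < r₁ → r₁ < Kerr.rPlus M a →
    ∀ {𝓢 : Spacetime.{0} 4} {χ : Kerr.region a r₁ → 𝓢.carrier} {Sig : Set 𝓢.carrier},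
    ContMDiffOn 𝓘(ℝ, E4) (𝓡 4) ((⊤ : ℕ∞) : WithTop ℕ∞) χ
        {x : Kerr.region a r₁ | 0 < (x : E4) 0 - bentHeight M a (Kerr.radius a (x : E4)) + (Kerr.radius a (x : E4) - r₁) / 4} →
    (∀ x : Kerr.region a r₁, 0 < (x : E4) 0 - bentHeight M a (Kerr.radius a (x : E4)) + (Kerr.radius a (x : E4) - r₁) / 4 →
      (∀ v w : E4, 𝓢.metric.val (χ x) (mfderiv 𝓘(ℝ, E4) (𝓡 4) χ x v) (mfderiv 𝓘(ℝ, E4) (𝓡 4) χ x w) =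
        Kerr.bilin M a (x : E4) v w) ∧
      𝓢.metric.val (χ x) (𝓢.timeOrientation.vectorField (χ x))
        (mfderiv 𝓘(ℝ, E4) (𝓡 4) χ x (Kerr.timeVector M a (x : E4))) < 0) →
    (∀ x : Kerr.region a r₁, (x : E4) 0 = bentHeight M a (Kerr.radius a (x : E4)) → χ x ∈ Sig) →
    𝓢.metric.causalFuture 𝓢.timeOrientation Sig ∩ 𝓢.metric.chronologicalPast 𝓢.timeOrientation
        (χ '' {x : Kerr.region a r₁ | Kerr.rPlus M a < Kerr.radius a (x : E4) ∧
          bentHeight M a (Kerr.radius a (x : E4)) ≤ (x : E4) 0}) ⊆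
      χ '' {x : Kerr.region a r₁ | Kerr.rPlus M a < Kerr.radius a (x : E4) ∧
          bentHeight M a (Kerr.radius a (x : E4)) ≤ (x : E4) 0} →
    ∀ {f : E4 → E4} {Θ : ℝ → E4 → ℝ},
    (∀ x : E4, τ₀ < x 0 → bentHeight M a (Kerr.radius a x) < (f x) 0) →
    (∀ x : E4, Kerr.radius a (f x) = Kerr.radius a x) →
    (∀ (t : ℝ) (y y' : E4), E4.spatialNorm y = E4.spatialNorm y' → Θ t y = Θ t y') →
    (∀ t₁ : ℝ, τ₀ ≤ t₁ → f '' {x : E4 | t₁ < x 0 ∧ Kerr.rPlus M a < Kerr.radius a x} =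
      {y : E4 | t₁ + Θ t₁ y < y 0 ∧ Kerr.rPlus M a < Kerr.radius a y}) →
    (∀ t₁ : ℝ, τ₀ < t₁ → f '' {x : E4 | x 0 = t₁ ∧ Kerr.rPlus M a < Kerr.radius a x} =
      {y : E4 | y 0 = t₁ + Θ t₁ y ∧ Kerr.rPlus M a < Kerr.radius a y}) →
    ∀ {U : TopologicalSpace.Opens E4}, (U : Set E4) = {x : E4 | τ₀ < x 0 ∧ r₁ < Kerr.radius a x} →
    ∀ {Φ : U → 𝓢.carrier}, (∀ (x : U) (hx : f x.1 ∈ Kerr.region a r₁), Φ x = χ ⟨f x.1, hx⟩) →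
    Φ '' {x : U | τ₀ < x.1 0 ∧ Kerr.rPlus M a < Kerr.radius a x.1} ⊆
      χ '' {x : Kerr.region a r₁ | Kerr.rPlus M a < Kerr.radius a (x : E4) ∧
          bentHeight M a (Kerr.radius a (x : E4)) ≤ (x : E4) 0} ∧
    χ '' {x : Kerr.region a r₁ | Kerr.rPlus M a < Kerr.radius a (x : E4) ∧
          bentHeight M a (Kerr.radius a (x : E4)) ≤ (x : E4) 0} =
      𝓢.metric.causalFuture 𝓢.timeOrientation Sig ∩ 𝓢.metric.chronologicalPast 𝓢.timeOrientation
        (Φ '' {x : U | τ₀ < x.1 0 ∧ Kerr.rPlus M a < Kerr.radius a x.1}) ∧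
    ∀ t₁ : ℝ, τ₀ < t₁ →
      χ '' {x : Kerr.region a r₁ | Kerr.rPlus M a < Kerr.radius a (x : E4) ∧
          bentHeight M a (Kerr.radius a (x : E4)) ≤ (x : E4) 0} \
          Φ '' {x : U | t₁ < x.1 0 ∧ Kerr.rPlus M a < Kerr.radius a x.1} ⊆
        𝓢.metric.causalPast 𝓢.timeOrientation (Φ '' {x : U | x.1 0 = t₁ ∧ Kerr.rPlus M a < Kerr.radius a x.1}) := by
  intro _ M a r₁ τ₀ ha hr₁ hr₂ 𝓢 χ Sig hχs hχg hSig hlast f Θ hleaf hrad hΘ himg hslab U hU Φ hΦ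
  have hM0 : 0 < M := mass_pos ha
  have hM : 0 ≤ M := hM0.le
  have hr₁0 : 0 ≤ r₁ := (rMinus_nonneg ha).trans hr₁.le
  have hUiff : ∀ y : E4, y ∈ U ↔ τ₀ < y 0 ∧ r₁ < Kerr.radius a y := fun y ↦ Set.ext_iff.1 hU y
  have hfmem : ∀ x : U, f x.1 ∈ Kerr.region a r₁ := fun x ↦ by
    rw [Kerr.mem_region, max_eq_left hr₁0, hrad]
    exact ((hUiff x.1).1 x.2).2
  -- chart images of `f`-images are `Φ`-images
  have hΦimg : ∀ {P : E4 → Prop}, (∀ y, P y → y ∈ U) → ∀ {z : Kerr.region a r₁},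
      (z : E4) ∈ f '' {y | P y} → χ z ∈ Φ '' {x : U | P x.1} := by
    intro P hPU z hz
    obtain ⟨y, hy, hyz⟩ := hz
    have hyU : y ∈ U := hPU y hy
    have hfy : f y ∈ Kerr.region a r₁ := by rw [hyz]; exact z.2
    refine ⟨⟨y, hyU⟩, hy, ?_⟩
    rw [hΦ ⟨y, hyU⟩ hfy]
    exact congrArg χ (Subtype.ext hyz)
  -- (a) the late exterior is mapped into `χ(O_K)`
  have ha' : Φ '' {x : U | τ₀ < x.1 0 ∧ Kerr.rPlus M a < Kerr.radius a x.1} ⊆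
      χ '' {x : Kerr.region a r₁ | Kerr.rPlus M a < Kerr.radius a (x : E4) ∧
          bentHeight M a (Kerr.radius a (x : E4)) ≤ (x : E4) 0} := by
    rintro _ ⟨x, hx, rfl⟩
    refine ⟨⟨f x.1, hfmem x⟩, ⟨?_, ?_⟩, (hΦ x (hfmem x)).symm⟩
    · show Kerr.rPlus M a < Kerr.radius a (f x.1)
      rw [hrad]
      exact hx.2
    · show bentHeight M a (Kerr.radius a (f x.1)) ≤ (f x.1) 0
      rw [hrad]
      exact (hleaf x.1 hx.1).le
  -- the helix of the sub-extremal exterior: constant `r`, constant `|x̲|`, time `x⁰ + Δ`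
  have helix : ∀ x : Kerr.region a r₁, Kerr.rPlus M a < Kerr.radius a (x : E4) → ∀ Δ : ℝ, 0 ≤ Δ →
      ∃ x' : Kerr.region a r₁, (x' : E4) 0 = (x : E4) 0 + Δ ∧ E4.spatialNorm (x' : E4) = E4.spatialNorm (x : E4) ∧
        Kerr.radius a (x' : E4) = Kerr.radius a (x : E4) ∧
        x' ∈ (Kerr.smoothMetric M a r₁).causalFuture ((Kerr.timeOrientation M a r₁ hM).ofLE le_top) {x} ∧
        (0 < Δ → x' ∈ (Kerr.smoothMetric M a r₁).chronologicalFuture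
          ((Kerr.timeOrientation M a r₁ hM).ofLE le_top) {x}) := by
    intro x hx Δ hΔ
    obtain ⟨x', hx', hr, hJ, hI⟩ := (stub_kerrExteriorHelix M a r₁ hM ha hr₁ hr₂ x hx).1 Δ hΔ
    refine ⟨x', ?_, ?_, hr, hJ, hI⟩
    · rw [hx']
      simp
    · rw [hx']
      exact causalTransport_spatialNorm_helix _ _ _
  refine ⟨ha', Subset.antisymm ?_ ?_, fun t₁ ht₁ ↦ ?_⟩
  · -- `χ(O_K) ⊆ J⁺(Σ) ∩ I⁻(Φ(late exterior))`
    rintro _ ⟨x, hxO, rfl⟩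
    refine ⟨?_, ?_⟩
    · -- from the leaf, along the helix
      have hJ := (stub_kerrExteriorHelix M a r₁ hM ha hr₁ hr₂ x hxO.1).2 hxO.2
      have h2 := image_causalFuture_subset_of_le (g := 𝓢.metric) (τ := 𝓢.timeOrientation) hM0 hM ha hχs hχg
        (S := {z : Kerr.region a r₁ | (z : E4) 0 = bentHeight M a (Kerr.radius a (z : E4))})
        (fun z hz ↦ le_of_eq (Eq.symm hz)) (mem_image_of_mem χ hJ)
      refine LorentzianMetric.causalFuture_mono ?_ h2
      rintro _ ⟨z, hz, rfl⟩
      exact hSig z hz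
    · -- to the epigraph `f({x⁰ > τ₀, r > r₊})`, along the helix
      obtain ⟨x', h0, hn, hr, -, hI⟩ := helix x hxO.1 (max (τ₀ + Θ τ₀ (x : E4) - (x : E4) 0) 0 + 1)
        (by positivity)
      have hx'mem : (x' : E4) ∈ f '' {y : E4 | τ₀ < y 0 ∧ Kerr.rPlus M a < Kerr.radius a y} := by
        rw [himg τ₀ le_rfl]
        refine ⟨?_, ?_⟩
        · rw [hΘ τ₀ (x' : E4) (x : E4) hn, h0]
          linarith [le_max_left (τ₀ + Θ τ₀ (x : E4) - (x : E4) 0) 0]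
        · rw [hr]
          exact hxO.1
      have hΦx' : χ x' ∈ Φ '' {x : U | τ₀ < x.1 0 ∧ Kerr.rPlus M a < Kerr.radius a x.1} :=
        hΦimg (P := fun y : E4 ↦ τ₀ < y 0 ∧ Kerr.rPlus M a < Kerr.radius a y)
          (fun y hy ↦ (hUiff y).2 ⟨hy.1, hr₂.trans hy.2⟩) hx'mem
      have h1 : x ∈ (Kerr.smoothMetric M a r₁).chronologicalPast ((Kerr.timeOrientation M a r₁ hM).ofLE le_top)
          {x'} :=
        LorentzianMetric.mem_chronologicalPast_of_mem_chronologicalFuture (hI (by positivity))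
      have h2 := mem_chronologicalPast_image_of_le (g := 𝓢.metric) (τ := 𝓢.timeOrientation) hM0 hM ha hχs hχg
        hxO.2 h1
      rw [image_singleton] at h2
      exact LorentzianMetric.chronologicalFuture_mono (singleton_subset_iff.2 hΦx') h2
  · -- `J⁺(Σ) ∩ I⁻(Φ(late exterior)) ⊆ χ(O_K)`: the last-exit inclusion
    rintro q ⟨hqJ, hqI⟩
    exact hlast ⟨hqJ, LorentzianMetric.chronologicalFuture_mono ha' hqI⟩
  · -- (c) exhaustion: climb the helix to the graph `f({x⁰ = t₁, r > r₊})`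
    rintro _ ⟨⟨x, hxO, rfl⟩, hq⟩
    have hle : (x : E4) 0 ≤ t₁ + Θ t₁ (x : E4) := by
      by_contra h
      have hxmem : (x : E4) ∈ f '' {y : E4 | t₁ < y 0 ∧ Kerr.rPlus M a < Kerr.radius a y} := by
        rw [himg t₁ ht₁.le]
        exact ⟨not_le.1 h, hxO.1⟩
      exact hq (hΦimg (P := fun y : E4 ↦ t₁ < y 0 ∧ Kerr.rPlus M a < Kerr.radius a y)
        (fun y hy ↦ (hUiff y).2 ⟨ht₁.trans hy.1, hr₂.trans hy.2⟩) hxmem)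
    obtain ⟨x', h0, hn, hr, hJ, -⟩ := helix x hxO.1 (t₁ + Θ t₁ (x : E4) - (x : E4) 0) (sub_nonneg.2 hle)
    have hx'mem : (x' : E4) ∈ f '' {y : E4 | y 0 = t₁ ∧ Kerr.rPlus M a < Kerr.radius a y} := by
      rw [hslab t₁ ht₁]
      refine ⟨?_, ?_⟩
      · rw [hΘ t₁ (x' : E4) (x : E4) hn, h0]
        ring
      · rw [hr]
        exact hxO.1
    have hΦx' : χ x' ∈ Φ '' {x : U | x.1 0 = t₁ ∧ Kerr.rPlus M a < Kerr.radius a x.1} :=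
      hΦimg (P := fun y : E4 ↦ y 0 = t₁ ∧ Kerr.rPlus M a < Kerr.radius a y)
        (fun y hy ↦ (hUiff y).2 ⟨ht₁.trans_eq hy.1.symm, hr₂.trans hy.2⟩) hx'mem
    have h1 : x ∈ (Kerr.smoothMetric M a r₁).causalPast ((Kerr.timeOrientation M a r₁ hM).ofLE le_top) {x'} :=
      LorentzianMetric.mem_causalPast_of_mem_causalFuture hJ
    have h2 := mem_causalPast_image_of_le (g := 𝓢.metric) (τ := 𝓢.timeOrientation) hM0 hM ha hχs hχg hxO.2 h1
    rw [image_singleton] at h2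
    exact LorentzianMetric.causalFuture_mono (singleton_subset_iff.2 hΦx') h2

/-! ## The registered stub, verbatim -/

/-- **T7 `stub_causalTransport` — transport of the causal clauses through `χ`.**  Given the shield data (`ψ` the
graph of `T = bentHeight M a` over the slice, `χ : Kerr.region a r₁ → 𝒟` smooth / open embedding / isometric /
oriented on the tapered collar `W = {0 < x⁰ − T(r) + (r − r₁)/4}` with `χ ∘ ψ = ι ∘ φ`), the helix of T4 and the
last-exit inclusion of T5 (both as hypotheses, verbatim), the bent lab chart facts of T2 at `rin = r₁` (above the
leaf, spatial point preserved, images of late sets and slabs), the pinned domain `U = {x⁰ > τ₀, r > r₁}` and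
`Φ = χ ∘ f` on `U`: with `O := χ(O_K)`, `O_K = {r > r₊, x⁰ ≥ T(r)}`, (a) `Φ(late exterior) ⊆ O`; (b)
`O = exteriorOf 𝒟 (Φ(late exterior)) = J⁺(ιX) ∩ I⁻(Φ(late exterior))`; (c) for every lab time `t₁ > τ₀`, every point
of `O` not in `Φ({x⁰ > t₁} ∩ exterior)` lies in `J⁻_𝒟(Φ({x⁰ = t₁} ∩ exterior))`.  One-line corollary of
`causalTransport_of_chart` in `𝒟.toSpacetime` with `Σ = ιX` (leaf points are `ψ y = graph y`, mapped to `ι(φ y)`: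
`psi_eq_graph`, `CollarEmbedsMGHD.exists_graph_eq_iff`) and `Θ(t, y) = χ₁(|y̲|/t − 1) · T(|y̲|)`; the abstract helix
hypothesis is superseded by the explicit helix `stub_kerrExteriorHelix` (which records `|x̲|`).  O'Neill 1983,
Ch. 14, pp. 402–403; DRSR arXiv:1402.7034, Lemma 4.7.1; Dafermos–Luk arXiv:1710.01722, Conjecture 1. -/
theorem stub_causalTransport : ∀ [Kerr.Facts] (X : Type) [TopologicalSpace X] [ChartedSpace E3 X]
    [IsManifold (𝓡 3) ((⊤ : ℕ∞) : WithTop ℕ∞) X] [T2Space X] [SecondCountableTopology X] [ConnectedSpace X]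
    (D : InitialDataSet (𝓡 3) X) (M a r₁ : ℝ) (hM : 0 ≤ M) (φ : Kerr.slice a r₁ → X)
    (ψ : Kerr.slice a r₁ → Kerr.region a r₁),
    |a| < M → Kerr.rMinus M a < r₁ → r₁ < Kerr.rPlus M a →
    (∀ y : Kerr.slice a r₁, (ψ y : E4) =
        E4.ofTimeSpace (bentHeight M a (Kerr.radius a (E4.ofTimeSpace 0 (y : E3)))) (y : E3)) →
    ∀ (𝒟 : VacuumCauchyDevelopment D) (χ : Kerr.region a r₁ → 𝒟.carrier),
      ContMDiffOn 𝓘(ℝ, E4) (𝓡 4) ((⊤ : ℕ∞) : WithTop ℕ∞) χ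
          {x : Kerr.region a r₁ | 0 < (x : E4) 0 - bentHeight M a (Kerr.radius a (x : E4)) +
            (Kerr.radius a (x : E4) - r₁) / 4} →
      Topology.IsOpenEmbedding (Set.restrict
          {x : Kerr.region a r₁ | 0 < (x : E4) 0 - bentHeight M a (Kerr.radius a (x : E4)) +
            (Kerr.radius a (x : E4) - r₁) / 4} χ) →
      (∀ x : Kerr.region a r₁, 0 < (x : E4) 0 - bentHeight M a (Kerr.radius a (x : E4)) +
            (Kerr.radius a (x : E4) - r₁) / 4 →
          (∀ v w : E4, 𝒟.metric.val (χ x) (mfderiv 𝓘(ℝ, E4) (𝓡 4) χ x v)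
              (mfderiv 𝓘(ℝ, E4) (𝓡 4) χ x w) = Kerr.bilin M a (x : E4) v w) ∧
          𝒟.metric.val (χ x) (𝒟.timeOrientation.vectorField (χ x))
              (mfderiv 𝓘(ℝ, E4) (𝓡 4) χ x (Kerr.timeVector M a (x : E4))) < 0) →
      (∀ y : Kerr.slice a r₁, χ (ψ y) = 𝒟.embed (φ y)) →
      -- T4 (the helix) at `(M, a, r₁)`
      (∀ p : Kerr.region a r₁, Kerr.rPlus M a < Kerr.radius a (p : E4) →
        ∃ γ : ℝ → Kerr.region a r₁, γ 0 = p ∧ (∀ s : ℝ, (γ s : E4) 0 = (p : E4) 0 + s) ∧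
          (∀ s : ℝ, Kerr.radius a (γ s : E4) = Kerr.radius a (p : E4)) ∧
          (Kerr.smoothMetric M a r₁).IsFutureTimelikeCurveOn
            ((Kerr.timeOrientation M a r₁ hM).ofLE le_top) γ Set.univ) →
      -- T5 (last exit)
      𝒟.metric.causalFuture 𝒟.timeOrientation (Set.range 𝒟.embed) ∩
          𝒟.metric.chronologicalPast 𝒟.timeOrientation (χ ''
            {x : Kerr.region a r₁ | Kerr.rPlus M a < Kerr.radius a (x : E4) ∧
            bentHeight M a (Kerr.radius a (x : E4)) ≤ (x : E4) 0}) ⊆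
        χ '' {x : Kerr.region a r₁ | Kerr.rPlus M a < Kerr.radius a (x : E4) ∧
            bentHeight M a (Kerr.radius a (x : E4)) ≤ (x : E4) 0} →
      ∀ τ₀ : ℝ, 0 < τ₀ →
      -- T2 at `rin = r₁` (above the leaf, spatial point preserved, images)
      (∀ x : E4, τ₀ < x 0 → bentHeight M a (Kerr.radius a x) <
        ((fun x : E4 ↦ x + (Real.smoothTransition (E4.spatialNorm x / x 0 - 1) *
            bentHeight M a (E4.spatialNorm x)) • E4.basisVector 0) x) 0) →
      (∀ x : E4,
        E4.spatial ((fun x : E4 ↦ x + (Real.smoothTransition (E4.spatialNorm x / x 0 - 1) *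
            bentHeight M a (E4.spatialNorm x)) • E4.basisVector 0) x) = E4.spatial x ∧
        Kerr.radius a ((fun x : E4 ↦ x + (Real.smoothTransition (E4.spatialNorm x / x 0 - 1) *
            bentHeight M a (E4.spatialNorm x)) • E4.basisVector 0) x) = Kerr.radius a x ∧
        ((fun x : E4 ↦ x + (Real.smoothTransition (E4.spatialNorm x / x 0 - 1) *
            bentHeight M a (E4.spatialNorm x)) • E4.basisVector 0) x) 0 = x 0 + Real.smoothTransition (E4.spatialNorm x / x 0 - 1) * bentHeight M a (E4.spatialNorm x)) →
      (∀ t₁ : ℝ, τ₀ ≤ t₁ → ∀ r₀ : ℝ, r₁ ≤ r₀ →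
        (fun x : E4 ↦ x + (Real.smoothTransition (E4.spatialNorm x / x 0 - 1) *
            bentHeight M a (E4.spatialNorm x)) • E4.basisVector 0) '' {x : E4 | t₁ < x 0 ∧ r₀ < Kerr.radius a x} =
          {y : E4 | t₁ + Real.smoothTransition (E4.spatialNorm y / t₁ - 1) * bentHeight M a (E4.spatialNorm y) < y 0 ∧
            r₀ < Kerr.radius a y}) →
      (∀ t₁ : ℝ, τ₀ < t₁ → ∀ r₀ : ℝ, r₁ ≤ r₀ →
        (fun x : E4 ↦ x + (Real.smoothTransition (E4.spatialNorm x / x 0 - 1) *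
            bentHeight M a (E4.spatialNorm x)) • E4.basisVector 0) '' {x : E4 | x 0 = t₁ ∧ r₀ < Kerr.radius a x} =
          {y : E4 | y 0 = t₁ + Real.smoothTransition (E4.spatialNorm y / t₁ - 1) * bentHeight M a (E4.spatialNorm y) ∧
            r₀ < Kerr.radius a y}) →
      ∀ (U : Opens E4), (U : Set E4) = {x : E4 | τ₀ < x 0 ∧ r₁ < Kerr.radius a x} →
      ∀ (Φ : U → 𝒟.carrier),
        (∀ (x : U) (hx : (fun x : E4 ↦ x + (Real.smoothTransition (E4.spatialNorm x / x 0 - 1) *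
            bentHeight M a (E4.spatialNorm x)) • E4.basisVector 0) x.1 ∈ Kerr.region a r₁), Φ x = χ ⟨(fun x : E4 ↦ x + (Real.smoothTransition (E4.spatialNorm x / x 0 - 1) *
            bentHeight M a (E4.spatialNorm x)) • E4.basisVector 0) x.1, hx⟩) →
      Φ '' {x : U | τ₀ < x.1 0 ∧ Kerr.rPlus M a < Kerr.radius a x.1} ⊆
        χ '' {x : Kerr.region a r₁ | Kerr.rPlus M a < Kerr.radius a (x : E4) ∧
            bentHeight M a (Kerr.radius a (x : E4)) ≤ (x : E4) 0} ∧
      χ '' {x : Kerr.region a r₁ | Kerr.rPlus M a < Kerr.radius a (x : E4) ∧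
            bentHeight M a (Kerr.radius a (x : E4)) ≤ (x : E4) 0} =
        Summit.FinalStateConjecture.exteriorOf 𝒟.toCauchyDevelopment
          (Φ '' {x : U | τ₀ < x.1 0 ∧ Kerr.rPlus M a < Kerr.radius a x.1}) ∧
      ∀ t₁ : ℝ, τ₀ < t₁ →
        χ '' {x : Kerr.region a r₁ | Kerr.rPlus M a < Kerr.radius a (x : E4) ∧
            bentHeight M a (Kerr.radius a (x : E4)) ≤ (x : E4) 0} \
            Φ '' {x : U | t₁ < x.1 0 ∧ Kerr.rPlus M a < Kerr.radius a x.1} ⊆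
          𝒟.metric.causalPast 𝒟.timeOrientation (Φ '' {x : U | x.1 0 = t₁ ∧ Kerr.rPlus M a < Kerr.radius a x.1}) := by
  intro _ X _ _ _ _ _ _ D M a r₁ _ φ ψ ha hr₁ hr₂ hψ 𝒟 χ hχs _ hχg hχψ _ hlast τ₀ _ hleaf hpres himg hslab U hU Φ hΦ
  obtain rfl : ψ = graph M a r₁ := psi_eq_graph rfl hψ
  -- leaf points of the chart are mapped into the Cauchy hypersurface `ιX`
  have hSig : ∀ x : Kerr.region a r₁, (x : E4) 0 = bentHeight M a (Kerr.radius a (x : E4)) →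
      χ x ∈ Set.range 𝒟.embed := by
    intro x hx
    obtain ⟨y, rfl⟩ := exists_graph_eq_iff.2 hx
    exact ⟨φ y, (hχψ y).symm⟩
  obtain ⟨h₁, h₂, h₃⟩ := causalTransport_of_chart (𝓢 := 𝒟.toSpacetime) (Sig := Set.range 𝒟.embed)
    (f := fun x : E4 ↦ x + (Real.smoothTransition (E4.spatialNorm x / x 0 - 1) *
      bentHeight M a (E4.spatialNorm x)) • E4.basisVector 0)
    (Θ := fun (t : ℝ) (y : E4) ↦ Real.smoothTransition (E4.spatialNorm y / t - 1) * bentHeight M a (E4.spatialNorm y))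
    ha hr₁ hr₂ hχs hχg hSig hlast hleaf (fun x ↦ (hpres x).2.1) (fun t y y' h ↦ by simp only [h])
    (fun t₁ ht₁ ↦ himg t₁ ht₁ _ hr₂.le) (fun t₁ ht₁ ↦ hslab t₁ ht₁ _ hr₂.le) hU hΦ
  exact ⟨h₁, by rw [Summit.FinalStateConjecture.exteriorOf]; exact h₂, h₃⟩

end Summit.FinalStateConjecture.FinalStateConjecture.Cruxes.ModulatedKerrHandoff.SwallowTransfer

end
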